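import Summits.QuantumFields.BalabanUV.T4Continuum.Support.NE7SliceIterationOrbit
import Summits.QuantumFields.BalabanUV.T4Continuum.Support.NE3CurlReverseReading
import HarnessLib

/-!
# NE7SliceInitialState — THE NEAR-REPRESENTATIVE IS AN ADMISSIBLE INITIAL STATE OF THE (S1) ITERATION (memo ROAD-G102 §2): a unitary `(tower)`-periodic CORNER-TRIVIAL
# gauge `u₀` with `‖W(b)⁻¹U′^{u₀}(b) − 1‖ ≤ b ≤ 1∕64` on every bond (gen 94's `pair_residual_sup_rep`, `b = 10³⁴ε∕M`) has the chart `U′^{u₀} = W·e^{X(u₀)}` with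
# `‖X(u₀)‖ ≤ 2b`, corner logs `h(u₀) = 0`, weighted size `‖(M·s, η_h)‖ ≤ 2Mb`, and DEFECT `Df(u₀) ≤ δ₀(b, x, x′)` read off the split of `T(u₀)` by
# `NE7SliceStepContraction.split_error_sized` (the curved sup letter (L) displayed as `hLet`) and the uniqueness `NE7SliceSplitUnique.slice_split_unique` — with
# `e_E = 2b·(1 + supC(3+12d)∕(1−θ))`, `c_E = x + x′ + 192b² + supCurlC(3+12d)·2b∕(M(1−θ))`, `e_c = 0`: every product `M·e_E`, `M²·c_E` is k-free when `b ≍ ε∕M`, `x, x′ ≍ ε∕M²`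

Cell `pub-balaban`, rung (B)+1 sub-cell t4, lineage `b2b-balaban-t4-ne7-p1`, generation 102 (CRUX PROVER NE7 #1 = OWNER of BINDER row NE7).  Memo `t4/b2b-balaban-t4-ne7-p1-g102/ROAD-G102.md` §2.
WHAT ([folklore]; 0 def, 0 sorry).  §1 `init_chart`, `init_norm_repLog_le`, `init_cornerLog`, `init_corner`, `init_sizePair`, `init_weighted_size`.  §2 `init_norm_coarseDatum_le`
(`‖φ(u₀)‖ ≤ (3+12d)M·2b`), `init_norm_tangentPart_le`, `init_norm_curlAt_repLog_le` (`‖curl_W X(u₀)‖ ≤ x + x′ + 48(2b)²`, row NE3's reverse curl reading), `init_norm_curlAt_tangentPart_le`,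
**`init_sliceDefect_le`** (the displayed `δ₀`).
HONEST FRAMING (page 1): bookkeeping over landed letters; nothing of Bałaban's asserted; NOT (S1) in full, NOT NE7; spine 0∕9; finite T⁴ rung (B)+1 — NOT infinite volume, NOT mass gap,
NOT BetaPertH, NOT Clay.  Continuum YM on T⁴ ⇐ BetaPertH ∧ nine spine estimates (0/9 proved); BetaPertH ⇐ (D1) ∧ (D4) ∧ CAP+tail; G-an2-4 gates asym, D1 and NE2/3/4.
-/

set_option autoImplicit false

open scoped BigOperators Matrix.Norms.L2Operator
open NormedSpace Finset

namespace Summit.QuantumFields.BalabanUV.T4Continuum.NE7SliceInitialState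

open Literature.MathematicalPhysics.QuantumFieldTheory.Balaban1983to89
open B7Prop1Explicit B7Prop2Explicit MatrixLog
open T4AveragingDeficitWall (IsUnitaryCfg IsSkewDir SmallField vary Ad curlAt)
open T4AveragingDeficitWallBoundary (IsPeriodicCfg periodBox)
open AveragingDeficitPeriodicCounting (IsPeriodicDir)
open AveragingDeficitTwoLevelPrep (prop1Radius)
open AveragingDeficitMultiLevelPrep (cavgIter LevelSmall tower cavgIter_unitary_small)
open BlockAveragePushDirGauge (gaugeDir)
open BlockAverageCurrent (smallField_gaugeAct)
open NE3EnergyShapes (IsUnitarySite IsPeriodicSite)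
open NE3TangentCovariantTower (dirIter framePotW)
open NE3CovariantBlockMean (bmeanIterW)
open NE3RightInverseSupLetters (frameC supC norm_rightInvW_le)
open NE3HatInvCurlLetters (supCurlC)
open NE3QbarIterCovLiftPrep (cruxC)
open NE3SmoothRightInverseW (rightInvW)
open NE3RightInverseLetters (rightInvW_R5 norm_curl_rightInvW_le)
open NE3LinearisedAverageSup (curvSum norm_dirIter_le_sup)
open NE3CurlOfGaugeDir (curlAt_sub)
open NE3CurlReverseReading (norm_curlAt_le_of_vary_poly)
open NE7MeanZeroGaugeSliceW (energyBlockLandauW)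
open NE7SliceSplitUnique (slice_split_unique)
open NE7SliceStepContraction (split_error_sized)
open NE7SliceStepErrorField (norm_curlAt_le_of_plaq)
open SpreadLift (loopRad)
open NE7SliceIterationState
open NE7SliceIterationStateFacts

noncomputable section

variable {d : ℕ} {n : Type*} [Fintype n] [DecidableEq n]

section Init

variable [Nonempty n] {L : ℕ} (hL : 2 ≤ L) (k : ℕ) {W : Site d → Fin d → (Matrix n n ℂ)ˣ} {x : ℝ} (hWu : IsUnitaryCfg W) (hx : 0 ≤ x) (hs : LevelSmall d L k x)
  (hWx : SmallField W x) (N : ℕ) [NeZero N] (hθ : cruxC d L * (((L : ℝ) ^ (k + 1)) ^ 2 * x) < 1) (U' : Site d → Fin d → (Matrix n n ℂ)ˣ)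
  (hWP : IsPeriodicCfg W ((tower L N (k + 1) : ℕ) : ℤ)) (hU'u : IsUnitaryCfg U') (hU'P : IsPeriodicCfg U' ((tower L N (k + 1) : ℕ) : ℤ))
  {u₀ : Site d → (Matrix n n ℂ)ˣ} (hu₀ : IsUnitarySite u₀) (hu₀P : IsPeriodicSite u₀ ((tower L N (k + 1) : ℕ) : ℤ))
  (hpin : ∀ z : Site d, u₀ (((L : ℤ) ^ (k + 1)) • z) = 1)
  {b : ℝ} (hb : ∀ (y : Site d) (κ : Fin d), ‖(((W y κ)⁻¹ * gaugeAct u₀ U' y κ : (Matrix n n ℂ)ˣ) : Matrix n n ℂ) - 1‖ ≤ b) (hb64 : b ≤ 1 / 64)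

/-! ## §1 Chart, sizes and corners of the near-representative -/

omit [Nonempty n] in
include hb hb64 in
/-- **THE CHART AT `u₀`**: `U′^{u₀} = W·e^{X(u₀)}` (`exp ∘ mlog = id` on `‖· − 1‖ < 1`). [folklore] -/
theorem init_chart : gaugeAct u₀ U' = vary W (repLog W U' u₀) 1 := by
  funext y κ
  apply Units.ext
  have hnear : ‖(((W y κ)⁻¹ : (Matrix n n ℂ)ˣ) : Matrix n n ℂ) * ((gaugeAct u₀ U' y κ : (Matrix n n ℂ)ˣ) : Matrix n n ℂ) - 1‖ < 1 := by
    have h := hb y κ; rw [Units.val_mul] at h; exact h.trans_lt (by linarith)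
  have hexp : exp (repLog W U' u₀ y κ) = (((W y κ)⁻¹ : (Matrix n n ℂ)ˣ) : Matrix n n ℂ) * ((gaugeAct u₀ U' y κ : (Matrix n n ℂ)ˣ) : Matrix n n ℂ) := by
    unfold repLog; exact exp_mlog hnear
  rw [vary, Units.val_mul, val_expUnit, Complex.ofReal_one, one_smul, hexp, ← mul_assoc, Units.mul_inv, one_mul]

omit [Nonempty n] in
include hb hb64 in
/-- **`‖X(u₀)‖ ≤ 2b`**. [folklore] -/
theorem init_norm_repLog_le (y : Site d) (κ : Fin d) : ‖repLog W U' u₀ y κ‖ ≤ 2 * b := by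
  have h := hb y κ
  rw [Units.val_mul] at h
  unfold repLog
  exact (norm_mlog_le_two_mul (h.trans (hb64.trans (by norm_num)))).trans (by linarith)

omit [Nonempty n] in
include hpin in
/-- **THE CORNER LOGS OF `u₀` VANISH**: `h(u₀) z = mlog 1 = 0`. [folklore] -/
theorem init_cornerLog (z : Site d) : cornerLog L k u₀ z = 0 := by
  simp only [cornerLog, hpin z, Units.val_one, mlog_one]

omit [Nonempty n] in
include hpin in
/-- the corner identity at `u₀`: `u₀(M•z) = exp (h(u₀) z)` (both sides `1`). [folklore] -/
theorem init_corner (z : Site d) : ((u₀ (((L : ℤ) ^ (k + 1)) • z) : (Matrix n n ℂ)ˣ) : Matrix n n ℂ) = exp (cornerLog L k u₀ z) := by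
  rw [init_cornerLog k hpin z, exp_zero, hpin z, Units.val_one]

omit [Nonempty n] in
include hL hpin hb hb64 in
/-- **THE SIZE PAIR OF `u₀`**: `s(u₀) ≤ 2b`, `η_h(u₀) ≤ 0` (`d ≥ 1`). [folklore] -/
theorem init_sizePair (hd : 0 < d) : (sizePair (L := L) (W := W) k N U' u₀).1 ≤ 2 * b ∧ (sizePair (L := L) (W := W) k N U' u₀).2 ≤ 0 := by
  haveI : NeZero L := ⟨by omega⟩
  have hP1 : 1 ≤ tower L N (k + 1) := Nat.one_le_iff_ne_zero.mpr (NeZero.ne _)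
  have hN1 : 1 ≤ N := Nat.one_le_iff_ne_zero.mpr (NeZero.ne _)
  have hb0 : 0 ≤ b := (norm_nonneg _).trans (hb 0 ⟨0, hd⟩)
  exact ⟨bondSup_le hP1 (by positivity) (init_norm_repLog_le U' hb hb64),
    siteSup_le hN1 fun z => by rw [init_cornerLog k hpin z, norm_zero]⟩

omit [Nonempty n] in
include hL hpin hb hb64 in
/-- **THE WEIGHTED SIZE OF `u₀`**: `‖(M·s(u₀), η_h(u₀))‖ ≤ 2Mb`. [folklore] -/
theorem init_weighted_size (hd : 0 < d) :
    ‖((L : ℝ) ^ (k + 1) * (sizePair (L := L) (W := W) k N U' u₀).1, (sizePair (L := L) (W := W) k N U' u₀).2)‖ ≤ 2 * (L : ℝ) ^ (k + 1) * b := by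
  obtain ⟨h1, h2⟩ := init_sizePair hL k N U' hpin hb hb64 hd
  have hM0 : 0 < (L : ℝ) ^ (k + 1) := by positivity
  have hb0 : 0 ≤ b := (norm_nonneg _).trans (hb 0 ⟨0, hd⟩)
  have h10 : 0 ≤ (sizePair (L := L) (W := W) k N U' u₀).1 := bondSup_nonneg fun y μ => norm_nonneg _
  have h20 : 0 ≤ (sizePair (L := L) (W := W) k N U' u₀).2 := siteSup_nonneg fun z => norm_nonneg _
  rw [Prod.norm_def, Real.norm_of_nonneg (mul_nonneg hM0.le h10), Real.norm_of_nonneg h20]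
  refine max_le ?_ (h2.trans (by positivity))
  have := mul_le_mul_of_nonneg_left h1 hM0.le
  linarith

/-! ## §2 The coarse datum, the tangent part and its curl at `u₀`; the defect -/

include hL hWu hx hs hWx hWP hU'u hU'P hu₀ hu₀P hpin hb hb64 in
/-- **`‖φ(u₀)‖ ≤ (3+12d)·M·2b`**: `φ(u₀) = dirIter X(u₀)` (the corner logs vanish) and row NE3's sup letter of the linearised average. [folklore] -/
theorem init_norm_coarseDatum_le (hA : curvSum d L (k + 1) x ≤ 2 / 3 * L) (z : Site d) (κ : Fin d) :
    ‖coarseDatum L k W U' u₀ z κ‖ ≤ (3 + 12 * (d : ℝ)) * (L : ℝ) ^ (k + 1) * (2 * b) := by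
  have hb0 : 0 ≤ b := (norm_nonneg _).trans (hb z κ)
  have hX8 : ∀ y κ, ‖repLog W U' u₀ y κ‖ ≤ 1 / 8 := fun y κ => (init_norm_repLog_le U' hb hb64 y κ).trans (by linarith)
  have hXsk := repLog_skew hWu U' hU'u hu₀ (init_chart U' hb hb64) hX8
  have hXP := repLog_periodic k N U' hWP hU'P hu₀P
  have h1 := norm_dirIter_le_sup hL k hWu hWP hx hs hWx hXsk hXP (by positivity : (0:ℝ) ≤ 2 * b) (init_norm_repLog_le U' hb hb64) hA z κ
  have hlam : cornerLog L k u₀ = fun _ => 0 := funext (init_cornerLog k hpin)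
  have h0 : gaugeDir (cavgIter L (k + 1) W) (cornerLog L k u₀) z κ = 0 := by
    rw [hlam]; simp only [gaugeDir, Ad, Matrix.mul_zero, Matrix.zero_mul, sub_zero]
  simp only [coarseDatum, h0, sub_zero]
  exact h1

include hWP hU'u hU'P hu₀ hu₀P hpin hb hb64 in
/-- **`‖T(u₀)‖ ≤ e_E := 2b + supC∕(M(1−θ))·(3+12d)M·2b`** (the sup letter (R5) of the right inverse). [folklore] -/
theorem init_norm_tangentPart_le (hA : curvSum d L (k + 1) x ≤ 2 / 3 * L) (hε : ((L : ℝ) ^ (k + 1)) ^ 2 * x ≤ 1) (y : Site d) (μ : Fin d) :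
    ‖tangentPart hL k hWu hx hs hWx N hθ U' u₀ y μ‖
      ≤ 2 * b + supC d L / ((L : ℝ) ^ (k + 1) * (1 - cruxC d L * (((L : ℝ) ^ (k + 1)) ^ 2 * x))) * ((3 + 12 * (d : ℝ)) * (L : ℝ) ^ (k + 1) * (2 * b)) := by
  have hb0 : 0 ≤ b := (norm_nonneg _).trans (hb y μ)
  have hX8 : ∀ y κ, ‖repLog W U' u₀ y κ‖ ≤ 1 / 8 := fun y κ => (init_norm_repLog_le U' hb hb64 y κ).trans (by linarith)
  have hh8 : ∀ z, ‖cornerLog L k u₀ z‖ ≤ 1 / 8 := fun z => by rw [init_cornerLog k hpin z, norm_zero]; norm_num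
  have hφ := (coarseDatum_skew_periodic hL k hWu hx hs hWx N U' hWP hU'u hU'P hu₀ hu₀P (init_chart U' hb hb64) hX8 (init_corner k hpin) hh8).1
  have hN := norm_rightInvW_le hL k hWu hx hs hWx N hθ hε hφ (by positivity) (init_norm_coarseDatum_le hL k hWu hx hs hWx N U' hWP hU'u hU'P hu₀ hu₀P hpin hb hb64 hA) y μ
  simp only [tangentPart, normalPart_eq hL k hWu hx hs hWx N hθ U' hφ]
  exact (norm_sub_le _ _).trans (add_le_add (init_norm_repLog_le U' hb hb64 y μ) hN)

include hWu hWx hU'u hu₀ hb hb64 in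
/-- **THE CURL OF `X(u₀)`**: `‖curl_W X(u₀)(p)‖ ≤ x + x′ + 48(2b)²` for `μ ≠ ν`, `SmallField W x`, `SmallField U′ x′` (row NE3's reverse curl reading: the dressed curl is the plaquette displacement up
to second order; the plaquettes of `U′^{u₀}` are those of `U′` conjugated). [folklore] -/
theorem init_norm_curlAt_repLog_le {x' : ℝ} (hU'x : SmallField U' x') (z : Site d) {μ ν : Fin d} (hμν : μ ≠ ν) :
    ‖curlAt W (repLog W U' u₀) z μ ν‖ ≤ x + x' + 48 * (2 * b) ^ 2 := by
  have hX8 : ∀ y κ, ‖repLog W U' u₀ y κ‖ ≤ 1 / 8 := fun y κ => (init_norm_repLog_le U' hb hb64 y κ).trans (by linarith)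
  have hchart := init_chart U' hb hb64 (u₀ := u₀)
  have hXsk := repLog_skew hWu U' hU'u hu₀ hchart hX8
  have h := norm_curlAt_le_of_vary_poly hWu hXsk (init_norm_repLog_le U' hb hb64) (by linarith) z μ ν
  have hx' : SmallField (vary W (repLog W U' u₀) 1) x' := hchart ▸ smallField_gaugeAct hu₀ hU'x
  have hdiff : ‖((hol (vary W (repLog W U' u₀) 1) z (plaqWord μ ν) : (Matrix n n ℂ)ˣ) : Matrix n n ℂ) - ((hol W z (plaqWord μ ν) : (Matrix n n ℂ)ˣ) : Matrix n n ℂ)‖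
      ≤ x + x' := by
    have e : ((hol (vary W (repLog W U' u₀) 1) z (plaqWord μ ν) : (Matrix n n ℂ)ˣ) : Matrix n n ℂ) - ((hol W z (plaqWord μ ν) : (Matrix n n ℂ)ˣ) : Matrix n n ℂ)
        = (((hol (vary W (repLog W U' u₀) 1) z (plaqWord μ ν) : (Matrix n n ℂ)ˣ) : Matrix n n ℂ) - 1) - (((hol W z (plaqWord μ ν) : (Matrix n n ℂ)ˣ) : Matrix n n ℂ) - 1) := by
      abel
    rw [e]
    exact (norm_sub_le _ _).trans (by linarith [hx' z μ ν hμν, hWx z μ ν hμν])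
  linarith

include hWP hU'u hU'P hu₀ hu₀P hpin hb hb64 in
/-- **THE CURL OF `T(u₀)`**: `‖curl_W T(u₀)‖ ≤ c_E := (x + x′ + 48(2b)²) + supCurlC∕(M²(1−θ))·(3+12d)M·2b` for `μ ≠ ν` ((R6′) for the normal part). [folklore] -/
theorem init_norm_curlAt_tangentPart_le (hA : curvSum d L (k + 1) x ≤ 2 / 3 * L) (hε : ((L : ℝ) ^ (k + 1)) ^ 2 * x ≤ 1) {x' : ℝ} (hU'x : SmallField U' x')
    (z : Site d) {μ ν : Fin d} (hμν : μ ≠ ν) :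
    ‖curlAt W (tangentPart hL k hWu hx hs hWx N hθ U' u₀) z μ ν‖
      ≤ (x + x' + 48 * (2 * b) ^ 2) + supCurlC d L / (((L : ℝ) ^ (k + 1)) ^ 2 * (1 - cruxC d L * (((L : ℝ) ^ (k + 1)) ^ 2 * x))) * ((3 + 12 * (d : ℝ)) * (L : ℝ) ^ (k + 1) * (2 * b)) := by
  have hb0 : 0 ≤ b := (norm_nonneg _).trans (hb z μ)
  have hX8 : ∀ y κ, ‖repLog W U' u₀ y κ‖ ≤ 1 / 8 := fun y κ => (init_norm_repLog_le U' hb hb64 y κ).trans (by linarith)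
  have hh8 : ∀ z, ‖cornerLog L k u₀ z‖ ≤ 1 / 8 := fun z => by rw [init_cornerLog k hpin z, norm_zero]; norm_num
  have hφ := (coarseDatum_skew_periodic hL k hWu hx hs hWx N U' hWP hU'u hU'P hu₀ hu₀P (init_chart U' hb hb64) hX8 (init_corner k hpin) hh8).1
  have hNc := norm_curlAt_le_of_plaq hWu (fun p => norm_curl_rightInvW_le (N := N) hL k hWu hx hs hWx hθ hε hφ (by positivity)
    (init_norm_coarseDatum_le hL k hWu hx hs hWx N U' hWP hU'u hU'P hu₀ hu₀P hpin hb hb64 hA) p) z hμν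
  have hXc := init_norm_curlAt_repLog_le hWu hWx U' hU'u hu₀ hb hb64 hU'x z hμν
  have e : tangentPart hL k hWu hx hs hWx N hθ U' u₀ = fun y κ => repLog W U' u₀ y κ - rightInvW hL k hWu hx hs hWx N hθ hφ y κ := by
    funext y κ; simp only [tangentPart, normalPart_eq hL k hWu hx hs hWx N hθ U' hφ]
  rw [e, curlAt_sub]
  exact (norm_sub_le _ _).trans (add_le_add hXc hNc)

include hWP hU'u hU'P hu₀ hu₀P hpin hb hb64 in
/-- **THE DEFECT OF THE NEAR-REPRESENTATIVE**: with `e_E`, `c_E` the displayed sup and curl sizes of `T(u₀)` and `e_c = 0`, on the class with Poincaré parameter `θ_P ≤ 1∕2`, the curved sup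
letter (L) displayed as `hLet` (constant `K`, absorption `16Kd·M²x ≤ 1∕2`), `M²x ≤ 1`, `curvSum ≤ 2L∕3`:
`Df(u₀) ≤ (e_E + s_E) + frameC·M·e_E∕M`, `s_E := 2KM·c_E + 8K(M²x)(frameC·M·e_E)∕M + 16Kd(M²x)e_E` — the split of `T(u₀)` against the datum `h(u₀) = 0` by `split_error_sized`, transferred
to the CHOSEN split by `slice_split_unique`. [folklore] -/
theorem init_sliceDefect_le (hd : 0 < d)
    (hθP : 4 * (d : ℝ) ^ 2 * ((L : ℝ) ^ (k + 1) - 1) ^ 2 * x + 16 * d * loopRad d L ((prop1Radius d L)^[k] x)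
      + 4 * d * ((d : ℝ) - 1) * ((L : ℝ) ^ (k + 1) - 1) ^ 2 * x ≤ 1 / 2)
    {K : ℝ} (hK : 0 ≤ K) (hKε : 16 * K * d * (((L : ℝ) ^ (k + 1)) ^ 2 * x) ≤ 1 / 2)
    (hLet : ∀ Y : Site d → Fin d → Matrix n n ℂ, Y ∈ energyBlockLandauW (d := d) (n := n) L N (k + 1) W →
      ∀ B : ℝ, (∀ (z : Site d) (μ ν : Fin d), μ ≠ ν → ‖curlAt W Y z μ ν‖ ≤ B) → ∀ (y : Site d) (κ : Fin d), ‖Y y κ‖ ≤ K * (L : ℝ) ^ (k + 1) * B)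
    (hε : ((L : ℝ) ^ (k + 1)) ^ 2 * x ≤ 1) (hA : curvSum d L (k + 1) x ≤ 2 / 3 * L) {x' : ℝ} (hx'0 : 0 ≤ x') (hU'x : SmallField U' x')
    {eE cE : ℝ}
    (heE : 2 * b + supC d L / ((L : ℝ) ^ (k + 1) * (1 - cruxC d L * (((L : ℝ) ^ (k + 1)) ^ 2 * x))) * ((3 + 12 * (d : ℝ)) * (L : ℝ) ^ (k + 1) * (2 * b)) ≤ eE)
    (hcE : (x + x' + 48 * (2 * b) ^ 2) + supCurlC d L / (((L : ℝ) ^ (k + 1)) ^ 2 * (1 - cruxC d L * (((L : ℝ) ^ (k + 1)) ^ 2 * x))) * ((3 + 12 * (d : ℝ)) * (L : ℝ) ^ (k + 1) * (2 * b))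
      ≤ cE) :
    sliceDefect hL k hWu hx hs hWx N hθ U' u₀
      ≤ (eE + (2 * K * (L : ℝ) ^ (k + 1) * cE + 8 * K * (((L : ℝ) ^ (k + 1)) ^ 2 * x) * (frameC d L * (L : ℝ) ^ (k + 1) * eE + 0) / (L : ℝ) ^ (k + 1)
          + 16 * K * d * (((L : ℝ) ^ (k + 1)) ^ 2 * x) * eE))
        + (frameC d L * (L : ℝ) ^ (k + 1) * eE + 0) / (L : ℝ) ^ (k + 1) := by
  haveI : NeZero L := ⟨by omega⟩
  have hP1 : 1 ≤ tower L N (k + 1) := Nat.one_le_iff_ne_zero.mpr (NeZero.ne _)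
  have hN1 : 1 ≤ N := Nat.one_le_iff_ne_zero.mpr (NeZero.ne _)
  have hM : 0 < (L : ℝ) ^ (k + 1) := by positivity
  have hb0 : 0 ≤ b := (norm_nonneg _).trans (hb 0 ⟨0, hd⟩)
  have h1θ : 0 < 1 - cruxC d L * (((L : ℝ) ^ (k + 1)) ^ 2 * x) := by linarith
  have hsC : 0 ≤ supC d L := by
    unfold supC NE3RightInverseSupLetters.corrC NE3RightInverseSupLetters.frameC; have := NE3QbarIterCovLiftPrep.liftC_nonneg d; positivity
  have hsCC : 0 ≤ supCurlC d L := by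
    unfold supCurlC NE3RightInverseSupLetters.frameC; have := NE3QbarIterCovLiftPrep.liftC_nonneg d; positivity
  have heE0 : 0 ≤ eE := le_trans (by positivity) heE
  have hcE0 : 0 ≤ cE := le_trans (by positivity) hcE
  have hX8 : ∀ y κ, ‖repLog W U' u₀ y κ‖ ≤ 1 / 8 := fun y κ => (init_norm_repLog_le U' hb hb64 y κ).trans (by linarith)
  have hh8 : ∀ z, ‖cornerLog L k u₀ z‖ ≤ 1 / 8 := fun z => by rw [init_cornerLog k hpin z, norm_zero]; norm_num
  have hchart := init_chart U' hb hb64 (u₀ := u₀)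
  have hcorner := init_corner k hpin (u₀ := u₀)
  -- the chosen split at `u₀`
  obtain ⟨hζ1s, hζ1P, hY1, hsplit1, hmean1⟩ := split_holds hL k hWu hx hs hWx N hθ U' hWP hU'u hU'P hu₀ hu₀P hchart hX8 hcorner hh8
  -- the sized split of `E := T(u₀)` against the datum `j := h(u₀)`
  have hEs := tangentPart_skew hL k hWu hx hs hWx N hθ U' hWP hU'u hU'P hu₀ hu₀P hchart hX8 hcorner hh8
  have hEP := tangentPart_periodic hL k hWu hx hs hWx N hθ U' hWP hU'u hU'P hu₀ hu₀P hchart hX8 hcorner hh8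
  have hdir := dirIter_tangentPart hL k hWu hx hs hWx N hθ U' hWP hU'u hU'P hu₀ hu₀P hchart hX8 hcorner hh8
  have hjs : ∀ z, cornerLog L k u₀ z ∈ skewAdjoint (Matrix n n ℂ) := cornerLog_skew k hu₀ hcorner hh8
  have hjP : ∀ (z : Site d) (i : Fin d), cornerLog L k u₀ (z + (N : ℤ) • e i) = cornerLog L k u₀ z := cornerLog_periodic k N hu₀P
  have hj0 : ∀ z, ‖cornerLog L k u₀ z‖ ≤ 0 := fun z => by rw [init_cornerLog k hpin z, norm_zero]
  have hEle : ∀ y κ, ‖tangentPart hL k hWu hx hs hWx N hθ U' u₀ y κ‖ ≤ eE := fun y κ =>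
    (init_norm_tangentPart_le hL k hWu hx hs hWx N hθ U' hWP hU'u hU'P hu₀ hu₀P hpin hb hb64 hA hε y κ).trans heE
  have hcEle : ∀ (z : Site d) (μ ν : Fin d), μ ≠ ν → ‖curlAt W (tangentPart hL k hWu hx hs hWx N hθ U' u₀) z μ ν‖ ≤ cE := fun z μ ν hμν =>
    (init_norm_curlAt_tangentPart_le hL k hWu hx hs hWx N hθ U' hWP hU'u hU'P hu₀ hu₀P hpin hb hb64 hA hε hU'x z hμν).trans hcE
  obtain ⟨ζE, YE, hζEs, hζEP, hYE, hsplitE, hmeanE, hmE, -, hδE, -⟩ :=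
    split_error_sized hd hL k hWu hWP hx hs hWx hθP hK hKε hLet hEs hEP hjs hjP hdir heE0 hcE0 hEle hcEle hj0
  -- uniqueness: the chosen split has the same `gaugeDir`
  have huniq := slice_split_unique k hWP (T := tangentPart hL k hWu hx hs hWx N hθ U' u₀) hYE hY1 hζEs hζEP hζ1s hζ1P hsplitE hsplit1
    (funext fun z => by rw [hmeanE z, hmean1 z])
  have hgD : ∀ y μ, ‖gaugeDir W (gaugeFun hL k hWu hx hs hWx N hθ U' u₀) y μ‖
      ≤ eE + (2 * K * (L : ℝ) ^ (k + 1) * cE + 8 * K * (((L : ℝ) ^ (k + 1)) ^ 2 * x) * (frameC d L * (L : ℝ) ^ (k + 1) * eE + 0) / (L : ℝ) ^ (k + 1)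
          + 16 * K * d * (((L : ℝ) ^ (k + 1)) ^ 2 * x) * eE) := fun y μ => by
    rw [← huniq.2 y μ]; exact hδE y μ
  have hfC : 0 ≤ frameC d L := by unfold frameC; positivity
  have hsE0 : 0 ≤ eE + (2 * K * (L : ℝ) ^ (k + 1) * cE + 8 * K * (((L : ℝ) ^ (k + 1)) ^ 2 * x) * (frameC d L * (L : ℝ) ^ (k + 1) * eE + 0) / (L : ℝ) ^ (k + 1)
      + 16 * K * d * (((L : ℝ) ^ (k + 1)) ^ 2 * x) * eE) := by positivity
  unfold sliceDefect frameMismatch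
  exact add_le_add (bondSup_le hP1 hsE0 hgD) (div_le_div_of_nonneg_right (siteSup_le hN1 hmE) hM.le)

end Init

end

end Summit.QuantumFields.BalabanUV.T4Continuum.NE7SliceInitialState
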